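import Summits.ValiantsHypothesis.ValiantsHypothesis.Theorems.LacunarySymmetroidMatrixDescartesPivotRankOneCriticalWindowsLoneBranch
import Summits.ValiantsHypothesis.ValiantsHypothesis.Theorems.LacunarySymmetroidMatrixDescartesPivotRankOneCriticalWindowsFourRequiredWeight

/-!
# `MatrixDescartes` census — rank-one `(2,K)₁`, lone letter: DERIVATIVES ALONG THE CRITICAL BRANCH, FOR ANY NUMBER OF LETTERS

HONEST FRAMING.  Object-search cell `pub-symmetroid`, seat `val-sym-mdr-p1` (generation 24); helper file `--supports` the crux item
stmt-ValiantsHypothesis-18050 (`Theses.LacunarySymmetroid.MatrixDescartes`, OPEN, on HOLD) with NO closure claim.  Calculus bookkeeping in the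
uniform `Finset` currency: the all-`K` forms of `…FourRequiredWeight` §3–§4 (generation 23).  Along a branch `T ↦ (φ T, ω T)` the point weights
are `Wₘ = (update w j (ω T))ₘ·(φ T)^{dₘ}` — base weights `wₘ`, the LONE weight replaced by the function `ω`; this file differentiates the
`Finset` sums built from them and converts the raw derivatives into the linear equations of `…LoneFoldAlgebra.xiDeriv_identity` and into the
fold derivative of `…FourFoldAlgebra.indexFormDeriv_at_fold`.  No count here; nothing on `MatrixDescartes` in its window, `DoorA26`/`DoorA34`,
registers / credences, `VP ≠ VNP`.

* §1 `hasDerivAt_branchSum` — GENERIC: `d/dT ∑ₘ (update w j (ω T))ₘ (φ T)^{dₘ} fₘ(T)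
  = ∑ₘ [(update w j O)ₘ·(dₘX^{dₘ−1}X′)·fₘ + (update w j O)ₘX^{dₘ}·fₘ′] + O′·X^{dⱼ}·fⱼ` (`X = φ T`, `O = ω T`). [folklore]
* §2 `euler_conversion` — `∑ (update w j O)ₘ(dₘX^{dₘ−1}X′)gₘ = (X′/X)·(κ∑Wₘgₘ + λ∑βₘWₘgₘ)` for coupled exponents `dₘ = κ + λβₘ`. [folklore]
* §3 `linearised_first/second` — the raw derivatives of (E1), (E2) along the branch, set to zero, ARE the two linear equations
  `(λS_{βg})q + Aⱼξ = −2T·A`, `(λS₂)q + βⱼuⱼ²ξ = −2S₁` (`q = X′/X`, `ξ = O′X^{dⱼ}`); `omegaDeriv_eq`: hence `ξ·λ·𝒟 = −2Tλ·𝒥`. [folklore]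
* §4 `hasDerivAt_indexForm` (the index form `𝒥 = 2S₁² − A·S₂` along the branch is differentiable, with its raw derivative) and
  `indexFormDeriv_eq_cubic`: at a point with `O′ = 0` and `𝒥 = 0`, `S₂²·𝒥′ = 2S₁·𝒞_W`. [folklore]
* §5 `sum_update_split`, `sum_update_of_zero` (sums with the lone weight replaced). [folklore]
* §6 `firstMoment_neg` — AT EVERY CRITICAL POINT ON THE LONE SIDE `S₁ < 0`, FOR ANY RATES: (E2) alone, with the left letters at `tₘ ≤ tₚ < T < tⱼ`
  and `βₘ ≥ 0` off the pivot, gives `∑βₘWₘ(T−tₘ)(tₚ−tₘ) > 0`, i.e. `(T−tₚ)·S₁ < 0` (the pivot rate cancels; «lone letter fastest» is NOT needed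
  for the sign of `S₁`, only — so far — for `𝒞_W > 0`). [folklore]
[folklore] One-variable calculus (`HasDerivAt.fun_sum`), polynomial identities.  No definitions, no named facts.
-/

-- `Summit.ValiantsHypothesis.ValiantsHypothesis.…` repeats a component by the D-0017 layout
-- (single-conjunct summit), which the `dupNamespace` linter flags; the name is mandated.
set_option linter.dupNamespace false

open Filter Topology

namespace Summit.ValiantsHypothesis.ValiantsHypothesis.Theorems.LacunarySymmetroidMatrixDescartes.Pivot.CriticalWindows.Lone

open Finset
open scoped BigOperators

/-! ## 1. The derivative of a branch sum -/

/-- **DERIVATIVE OF A BRANCH SUM.**  See the module docstring. [folklore] -/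
theorem hasDerivAt_branchSum {ι : Type*} [DecidableEq ι] (s : Finset ι) (w : ι → ℝ) (d : ι → ℕ) (j : ι) (hj : j ∈ s)
    {φ ω : ℝ → ℝ} {T XP OP : ℝ} (f : ι → ℝ → ℝ) (f' : ι → ℝ)
    (hφ : HasDerivAt φ XP T) (hω : HasDerivAt ω OP T) (hf : ∀ m ∈ s, HasDerivAt (f m) (f' m) T) :
    HasDerivAt (fun T' : ℝ => ∑ m ∈ s, Function.update w j (ω T') m * φ T' ^ d m * f m T')
      ((∑ m ∈ s, (Function.update w j (ω T) m * ((d m : ℝ) * φ T ^ (d m - 1) * XP) * f m T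
          + Function.update w j (ω T) m * φ T ^ d m * f' m)) + OP * φ T ^ d j * f j T) T := by
  have hterm : ∀ m ∈ s, HasDerivAt (fun T' : ℝ => Function.update w j (ω T') m * φ T' ^ d m * f m T')
      ((Function.update w j (ω T) m * ((d m : ℝ) * φ T ^ (d m - 1) * XP) * f m T
          + Function.update w j (ω T) m * φ T ^ d m * f' m) + (if m = j then OP * φ T ^ d j * f j T else 0)) T := by
    intro m hm
    by_cases hmj : m = j
    · subst hmj
      have e : (fun T' : ℝ => Function.update w m (ω T') m * φ T' ^ d m * f m T') = fun T' => ω T' * φ T' ^ d m * f m T' := by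
        funext T'; rw [Function.update_self]
      rw [e, Function.update_self, if_pos rfl]
      have h := (hω.fun_mul (hφ.fun_pow (d m))).fun_mul (hf m hm)
      refine h.congr_deriv ?_
      ring
    · have e : (fun T' : ℝ => Function.update w j (ω T') m * φ T' ^ d m * f m T') = fun T' => w m * φ T' ^ d m * f m T' := by
        funext T'; rw [Function.update_of_ne hmj]
      rw [e, Function.update_of_ne hmj, if_neg hmj, add_zero]
      have h := ((hφ.fun_pow (d m)).const_mul (w m)).fun_mul (hf m hm)
      refine h.congr_deriv ?_
      ring
  have hsum := HasDerivAt.fun_sum hterm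
  refine hsum.congr_deriv ?_
  rw [Finset.sum_add_distrib, Finset.sum_ite_eq' s j, if_pos hj]

/-! ## 2. Euler conversion for coupled exponents -/

/-- Per letter: `u·(d·X^{d−1}·X′)·g = (X′/X)·(d·(uX^d)·g)` for `X ≠ 0`. [folklore] -/
theorem euler_term (u X XP g : ℝ) (d : ℕ) (hX : X ≠ 0) :
    u * ((d : ℝ) * X ^ (d - 1) * XP) * g = (XP / X) * ((d : ℝ) * (u * X ^ d) * g) := by
  rw [Four.weightDeriv_eq u X XP d hX]
  ring

/-- **EULER CONVERSION.**  With `dₘ = κ + λβₘ` on `s` and `Wₘ = (update w j O)ₘX^{dₘ}`: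
`∑ (update w j O)ₘ(dₘX^{dₘ−1}X′)gₘ = (X′/X)·(κ∑Wₘgₘ + λ∑βₘWₘgₘ)`. [folklore] -/
theorem euler_conversion {ι : Type*} [DecidableEq ι] (s : Finset ι) (β w g : ι → ℝ) (d : ι → ℕ) (j : ι) (X XP O κ lam : ℝ)
    (hX : X ≠ 0) (hd : ∀ m ∈ s, (d m : ℝ) = κ + lam * β m) :
    ∑ m ∈ s, Function.update w j O m * ((d m : ℝ) * X ^ (d m - 1) * XP) * g m
      = (XP / X) * (κ * (∑ m ∈ s, (Function.update w j O m * X ^ d m) * g m)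
          + lam * ∑ m ∈ s, β m * (Function.update w j O m * X ^ d m) * g m) := by
  rw [← coupled_sum, Finset.mul_sum]
  refine Finset.sum_congr rfl fun m hm => ?_
  rw [euler_term _ _ _ _ _ hX, ← hd m hm]

/-! ## 3. The linearised critical equations and the derivative of the lone weight -/

/-- **LINEARISED FIRST EQUATION.**  If the raw derivative of `∑Wₘ(T²−tₘ²)` along the branch vanishes and (E1) holds at the point, then
`(λ·S_{βg})·q + (T²−tⱼ²)·ξ = −2T·A` with `q = X′/X`, `ξ = O′X^{dⱼ}`. [folklore] -/
theorem linearised_first {ι : Type*} [DecidableEq ι] (s : Finset ι) (β t w : ι → ℝ) (d : ι → ℕ) (j : ι)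
    (T X XP O OP κ lam : ℝ) (hX : X ≠ 0) (hd : ∀ m ∈ s, (d m : ℝ) = κ + lam * β m)
    (hE1 : ∑ m ∈ s, (Function.update w j O m * X ^ d m) * (T ^ 2 - t m ^ 2) = 0)
    (hraw : (∑ m ∈ s, (Function.update w j O m * ((d m : ℝ) * X ^ (d m - 1) * XP) * (T ^ 2 - t m ^ 2)
        + Function.update w j O m * X ^ d m * (2 * T))) + OP * X ^ d j * (T ^ 2 - t j ^ 2) = 0) :
    (lam * ∑ m ∈ s, β m * (Function.update w j O m * X ^ d m) * (T ^ 2 - t m ^ 2)) * (XP / X)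
        + (T ^ 2 - t j ^ 2) * (OP * X ^ d j)
      = -(2 * T) * ∑ m ∈ s, (Function.update w j O m * X ^ d m) := by
  rw [Finset.sum_add_distrib, euler_conversion s β w _ d j X XP O κ lam hX hd, hE1, mul_zero, zero_add] at hraw
  have h2T : ∑ m ∈ s, Function.update w j O m * X ^ d m * (2 * T) = (2 * T) * ∑ m ∈ s, (Function.update w j O m * X ^ d m) := by
    rw [Finset.mul_sum]; exact Finset.sum_congr rfl fun m _ => by ring
  rw [h2T] at hraw
  linear_combination hraw

/-- **LINEARISED SECOND EQUATION.**  If the raw derivative of `∑βₘWₘ(T−tₘ)²` along the branch vanishes and (E2) holds at the point, then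
`(λ·S₂)·q + βⱼ(T−tⱼ)²·ξ = −2S₁`. [folklore] -/
theorem linearised_second {ι : Type*} [DecidableEq ι] (s : Finset ι) (β t w : ι → ℝ) (d : ι → ℕ) (j : ι)
    (T X XP O OP κ lam : ℝ) (hX : X ≠ 0) (hd : ∀ m ∈ s, (d m : ℝ) = κ + lam * β m)
    (hE2 : ∑ m ∈ s, β m * (Function.update w j O m * X ^ d m) * (T - t m) ^ 2 = 0)
    (hraw : (∑ m ∈ s, (Function.update w j O m * ((d m : ℝ) * X ^ (d m - 1) * XP) * (β m * (T - t m) ^ 2)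
        + Function.update w j O m * X ^ d m * (β m * (2 * (T - t m))))) + OP * X ^ d j * (β j * (T - t j) ^ 2) = 0) :
    (lam * ∑ m ∈ s, β m ^ 2 * (Function.update w j O m * X ^ d m) * (T - t m) ^ 2) * (XP / X)
        + (β j * (T - t j) ^ 2) * (OP * X ^ d j)
      = -2 * ∑ m ∈ s, β m * (Function.update w j O m * X ^ d m) * (T - t m) := by
  rw [Finset.sum_add_distrib, euler_conversion s β w _ d j X XP O κ lam hX hd] at hraw
  have e1 : ∑ m ∈ s, (Function.update w j O m * X ^ d m) * (β m * (T - t m) ^ 2)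
      = ∑ m ∈ s, β m * (Function.update w j O m * X ^ d m) * (T - t m) ^ 2 := Finset.sum_congr rfl fun m _ => by ring
  have e2 : ∑ m ∈ s, β m * (Function.update w j O m * X ^ d m) * (β m * (T - t m) ^ 2)
      = ∑ m ∈ s, β m ^ 2 * (Function.update w j O m * X ^ d m) * (T - t m) ^ 2 := Finset.sum_congr rfl fun m _ => by ring
  have e3 : ∑ m ∈ s, Function.update w j O m * X ^ d m * (β m * (2 * (T - t m)))
      = 2 * ∑ m ∈ s, β m * (Function.update w j O m * X ^ d m) * (T - t m) := by
    rw [Finset.mul_sum]; exact Finset.sum_congr rfl fun m _ => by ring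
  rw [e1, e2, e3, hE2, mul_zero, zero_add] at hraw
  linear_combination hraw

/-- **THE DERIVATIVE OF THE LONE WEIGHT ALONG THE BRANCH.**  From the two vanishing raw derivatives and (E1), (E2) at the point:
`(O′X^{dⱼ})·λ·𝒟 = −2Tλ·𝒥` (`𝒟`, `𝒥` of the point weights `Wₘ = (update w j O)ₘX^{dₘ}`). [folklore] -/
theorem omegaDeriv_eq {ι : Type*} [DecidableEq ι] (s : Finset ι) (β t w : ι → ℝ) (d : ι → ℕ) (j : ι)
    (T X XP O OP κ lam : ℝ) (hX : X ≠ 0) (hd : ∀ m ∈ s, (d m : ℝ) = κ + lam * β m)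
    (hE1 : ∑ m ∈ s, (Function.update w j O m * X ^ d m) * (T ^ 2 - t m ^ 2) = 0)
    (hE2 : ∑ m ∈ s, β m * (Function.update w j O m * X ^ d m) * (T - t m) ^ 2 = 0)
    (hraw1 : (∑ m ∈ s, (Function.update w j O m * ((d m : ℝ) * X ^ (d m - 1) * XP) * (T ^ 2 - t m ^ 2)
        + Function.update w j O m * X ^ d m * (2 * T))) + OP * X ^ d j * (T ^ 2 - t j ^ 2) = 0)
    (hraw2 : (∑ m ∈ s, (Function.update w j O m * ((d m : ℝ) * X ^ (d m - 1) * XP) * (β m * (T - t m) ^ 2)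
        + Function.update w j O m * X ^ d m * (β m * (2 * (T - t m))))) + OP * X ^ d j * (β j * (T - t j) ^ 2) = 0) :
    (OP * X ^ d j) * (lam * (β j * (T - t j) ^ 2 * (∑ m ∈ s, β m * (Function.update w j O m * X ^ d m) * (T ^ 2 - t m ^ 2))
        + (t j ^ 2 - T ^ 2) * ∑ m ∈ s, β m ^ 2 * (Function.update w j O m * X ^ d m) * (T - t m) ^ 2))
      = -(2 * T) * lam * (2 * (∑ m ∈ s, β m * (Function.update w j O m * X ^ d m) * (T - t m)) ^ 2
        - (∑ m ∈ s, (Function.update w j O m * X ^ d m)) * ∑ m ∈ s, β m ^ 2 * (Function.update w j O m * X ^ d m) * (T - t m) ^ 2) := by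
  have hl1 := linearised_first s β t w d j T X XP O OP κ lam hX hd hE1 hraw1
  have hl2 := linearised_second s β t w d j T X XP O OP κ lam hX hd hE2 hraw2
  exact xiDeriv_identity s β t (fun m => Function.update w j O m * X ^ d m) T lam (XP / X) (OP * X ^ d j) j hE2 hl1 hl2

/-! ## 4. The index form along the branch -/

/-- **THE INDEX FORM ALONG THE BRANCH IS DIFFERENTIABLE**, with its raw derivative. [folklore] -/
theorem hasDerivAt_indexForm {ι : Type*} [DecidableEq ι] (s : Finset ι) (β t w : ι → ℝ) (d : ι → ℕ) (j : ι) (hj : j ∈ s)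
    {φ ω : ℝ → ℝ} {T XP OP : ℝ} (hφ : HasDerivAt φ XP T) (hω : HasDerivAt ω OP T) :
    HasDerivAt (fun T' : ℝ =>
        2 * (∑ m ∈ s, Function.update w j (ω T') m * φ T' ^ d m * (β m * (T' - t m))) ^ 2
          - (∑ m ∈ s, Function.update w j (ω T') m * φ T' ^ d m * (1:ℝ))
            * (∑ m ∈ s, Function.update w j (ω T') m * φ T' ^ d m * (β m ^ 2 * (T' - t m) ^ 2)))
      (2 * (2 * (∑ m ∈ s, Function.update w j (ω T) m * φ T ^ d m * (β m * (T - t m)))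
            * ((∑ m ∈ s, (Function.update w j (ω T) m * ((d m : ℝ) * φ T ^ (d m - 1) * XP) * (β m * (T - t m))
                + Function.update w j (ω T) m * φ T ^ d m * (β m))) + OP * φ T ^ d j * (β j * (T - t j))))
        - (((∑ m ∈ s, (Function.update w j (ω T) m * ((d m : ℝ) * φ T ^ (d m - 1) * XP) * (1:ℝ)
                + Function.update w j (ω T) m * φ T ^ d m * (0:ℝ))) + OP * φ T ^ d j * (1:ℝ))
              * (∑ m ∈ s, Function.update w j (ω T) m * φ T ^ d m * (β m ^ 2 * (T - t m) ^ 2))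
            + (∑ m ∈ s, Function.update w j (ω T) m * φ T ^ d m * (1:ℝ))
              * ((∑ m ∈ s, (Function.update w j (ω T) m * ((d m : ℝ) * φ T ^ (d m - 1) * XP) * (β m ^ 2 * (T - t m) ^ 2)
                  + Function.update w j (ω T) m * φ T ^ d m * (β m ^ 2 * (2 * (T - t m))))) + OP * φ T ^ d j * (β j ^ 2 * (T - t j) ^ 2)))) T := by
  have hS1 := hasDerivAt_branchSum s w d j hj (fun m T' => β m * (T' - t m)) (fun m => β m) hφ hω
    (fun m _ => by simpa using ((hasDerivAt_id T).sub_const (t m)).const_mul (β m))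
  have hA := hasDerivAt_branchSum s w d j hj (fun _ _ => (1:ℝ)) (fun _ => (0:ℝ)) hφ hω
    (fun m _ => hasDerivAt_const T (1:ℝ))
  have hS2 := hasDerivAt_branchSum s w d j hj (fun m T' => β m ^ 2 * (T' - t m) ^ 2) (fun m => β m ^ 2 * (2 * (T - t m))) hφ hω
    (fun m _ => ((Four.hasDerivAt_sq_sub (t m) T).2).const_mul (β m ^ 2))
  exact ((hS1.fun_pow 2).const_mul 2 |>.congr_deriv (by simp)).fun_sub (hA.fun_mul hS2)

/-- **`S₂²·𝒥′ = 2S₁·𝒞_W` AT A STATIONARY POINT OF THE LONE WEIGHT ON THE FOLD.**  With `O′ = 0`, `X ≠ 0`, coupled exponents, (E2) at the point,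
the second raw derivative vanishing (which gives `q·λS₂ = −2S₁`) and the fold relation `A·S₂ = 2S₁²`, the raw derivative of the index form
(as in `hasDerivAt_indexForm` with `O′ = 0`) times `S₂²` equals `2S₁·𝒞_W`. [folklore] -/
theorem indexFormDeriv_eq_cubic {ι : Type*} [DecidableEq ι] (s : Finset ι) (β t w : ι → ℝ) (d : ι → ℕ) (j : ι)
    (T X XP O κ lam : ℝ) (hX : X ≠ 0) (hlam : lam ≠ 0) (hd : ∀ m ∈ s, (d m : ℝ) = κ + lam * β m)
    (hS2 : ∑ m ∈ s, β m ^ 2 * (Function.update w j O m * X ^ d m) * (T - t m) ^ 2 ≠ 0)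
    (hE2 : ∑ m ∈ s, β m * (Function.update w j O m * X ^ d m) * (T - t m) ^ 2 = 0)
    (hraw2 : (∑ m ∈ s, (Function.update w j O m * ((d m : ℝ) * X ^ (d m - 1) * XP) * (β m * (T - t m) ^ 2)
        + Function.update w j O m * X ^ d m * (β m * (2 * (T - t m))))) + 0 * X ^ d j * (β j * (T - t j) ^ 2) = 0)
    (hfold : (∑ m ∈ s, (Function.update w j O m * X ^ d m))
        * (∑ m ∈ s, β m ^ 2 * (Function.update w j O m * X ^ d m) * (T - t m) ^ 2)
      = 2 * (∑ m ∈ s, β m * (Function.update w j O m * X ^ d m) * (T - t m)) ^ 2) :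
    (∑ m ∈ s, β m ^ 2 * (Function.update w j O m * X ^ d m) * (T - t m) ^ 2) ^ 2 *
      (2 * (2 * (∑ m ∈ s, Function.update w j O m * X ^ d m * (β m * (T - t m)))
            * ((∑ m ∈ s, (Function.update w j O m * ((d m : ℝ) * X ^ (d m - 1) * XP) * (β m * (T - t m))
                + Function.update w j O m * X ^ d m * (β m))) + 0 * X ^ d j * (β j * (T - t j))))
        - (((∑ m ∈ s, (Function.update w j O m * ((d m : ℝ) * X ^ (d m - 1) * XP) * (1:ℝ)
                + Function.update w j O m * X ^ d m * (0:ℝ))) + 0 * X ^ d j * (1:ℝ))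
              * (∑ m ∈ s, Function.update w j O m * X ^ d m * (β m ^ 2 * (T - t m) ^ 2))
            + (∑ m ∈ s, Function.update w j O m * X ^ d m * (1:ℝ))
              * ((∑ m ∈ s, (Function.update w j O m * ((d m : ℝ) * X ^ (d m - 1) * XP) * (β m ^ 2 * (T - t m) ^ 2)
                  + Function.update w j O m * X ^ d m * (β m ^ 2 * (2 * (T - t m))))) + 0 * X ^ d j * (β j ^ 2 * (T - t j) ^ 2))))
      = 2 * (∑ m ∈ s, β m * (Function.update w j O m * X ^ d m) * (T - t m))
          * (3 * (∑ m ∈ s, β m * (Function.update w j O m * X ^ d m))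
                * (∑ m ∈ s, β m ^ 2 * (Function.update w j O m * X ^ d m) * (T - t m) ^ 2) ^ 2
            - 6 * (∑ m ∈ s, β m ^ 2 * (Function.update w j O m * X ^ d m) * (T - t m))
                * (∑ m ∈ s, β m * (Function.update w j O m * X ^ d m) * (T - t m))
                * (∑ m ∈ s, β m ^ 2 * (Function.update w j O m * X ^ d m) * (T - t m) ^ 2)
            + 2 * (∑ m ∈ s, β m ^ 3 * (Function.update w j O m * X ^ d m) * (T - t m) ^ 2)
                * (∑ m ∈ s, β m * (Function.update w j O m * X ^ d m) * (T - t m)) ^ 2) := by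
  -- the linearised second equation with `ξ = 0`
  have hl2 := linearised_second s β t w d j T X XP O 0 κ lam hX hd hE2 hraw2
  rw [zero_mul, mul_zero, add_zero] at hl2
  -- name the point sums
  set W : ι → ℝ := fun m => Function.update w j O m * X ^ d m with hW
  have hWm : ∀ m, Function.update w j O m * X ^ d m = W m := fun m => rfl
  simp only [hWm] at hl2 hS2 hE2 hfold ⊢
  -- convert every raw sum into the basic sums
  have cS1a : ∑ m ∈ s, Function.update w j O m * ((d m : ℝ) * X ^ (d m - 1) * XP) * (β m * (T - t m))
      = (XP / X) * (κ * (∑ m ∈ s, W m * (β m * (T - t m))) + lam * ∑ m ∈ s, β m * W m * (β m * (T - t m))) :=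
    euler_conversion s β w _ d j X XP O κ lam hX hd
  have cAa : ∑ m ∈ s, Function.update w j O m * ((d m : ℝ) * X ^ (d m - 1) * XP) * (1:ℝ)
      = (XP / X) * (κ * (∑ m ∈ s, W m * (1:ℝ)) + lam * ∑ m ∈ s, β m * W m * (1:ℝ)) :=
    euler_conversion s β w _ d j X XP O κ lam hX hd
  have cS2a : ∑ m ∈ s, Function.update w j O m * ((d m : ℝ) * X ^ (d m - 1) * XP) * (β m ^ 2 * (T - t m) ^ 2)
      = (XP / X) * (κ * (∑ m ∈ s, W m * (β m ^ 2 * (T - t m) ^ 2)) + lam * ∑ m ∈ s, β m * W m * (β m ^ 2 * (T - t m) ^ 2)) :=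
    euler_conversion s β w _ d j X XP O κ lam hX hd
  rw [Finset.sum_add_distrib, Finset.sum_add_distrib, Finset.sum_add_distrib, cS1a, cAa, cS2a]
  -- normal forms of the remaining sums
  have n1 : ∑ m ∈ s, W m * (β m * (T - t m)) = ∑ m ∈ s, β m * W m * (T - t m) := Finset.sum_congr rfl fun m _ => by ring
  have n2 : ∑ m ∈ s, β m * W m * (β m * (T - t m)) = ∑ m ∈ s, β m ^ 2 * W m * (T - t m) := Finset.sum_congr rfl fun m _ => by ring
  have n3 : ∑ m ∈ s, W m * (1:ℝ) = ∑ m ∈ s, W m := Finset.sum_congr rfl fun m _ => by ring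
  have n4 : ∑ m ∈ s, β m * W m * (1:ℝ) = ∑ m ∈ s, β m * W m := Finset.sum_congr rfl fun m _ => by ring
  have n5 : ∑ m ∈ s, W m * (β m ^ 2 * (T - t m) ^ 2) = ∑ m ∈ s, β m ^ 2 * W m * (T - t m) ^ 2 := Finset.sum_congr rfl fun m _ => by ring
  have n6 : ∑ m ∈ s, β m * W m * (β m ^ 2 * (T - t m) ^ 2) = ∑ m ∈ s, β m ^ 3 * W m * (T - t m) ^ 2 :=
    Finset.sum_congr rfl fun m _ => by ring
  have n7 : ∑ m ∈ s, W m * (β m) = ∑ m ∈ s, β m * W m := Finset.sum_congr rfl fun m _ => by ring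
  have n8 : ∑ m ∈ s, W m * (0:ℝ) = 0 := by simp
  have n9 : ∑ m ∈ s, W m * (β m ^ 2 * (2 * (T - t m))) = 2 * ∑ m ∈ s, β m ^ 2 * W m * (T - t m) := by
    rw [Finset.mul_sum]; exact Finset.sum_congr rfl fun m _ => by ring
  rw [n1, n2, n3, n4, n5, n6, n7, n8, n9]
  -- the scalar identity
  set S1 := ∑ m ∈ s, β m * W m * (T - t m) with hS1
  set S2 := ∑ m ∈ s, β m ^ 2 * W m * (T - t m) ^ 2 with hS2'
  set A := ∑ m ∈ s, W m with hA
  set B0 := ∑ m ∈ s, β m * W m with hB0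
  set B2 := ∑ m ∈ s, β m ^ 2 * W m * (T - t m) with hB2
  set B3 := ∑ m ∈ s, β m ^ 3 * W m * (T - t m) ^ 2 with hB3
  set q := XP / X with hq
  have hq' : q * (lam * S2) = -2 * S1 := by rw [hq]; linear_combination hl2
  have key := Four.indexFormDeriv_at_fold (S₁ := S1) (S₂ := S2) (A := A) (B₀ := B0) (B₂ := B2) (B₃ := B3) (q := q) (lam := lam)
    (c := κ) hS2 hlam hq' hfold
  linear_combination key

/-! ## 5. Splitting a sum at the lone letter -/

/-- `∑ₛ (update w j O)ₘ·aₘ·gₘ = ∑_{s∖j} wₘaₘgₘ + O·aⱼ·gⱼ` for `j ∈ s`. [folklore] -/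
theorem sum_update_split {ι : Type*} [DecidableEq ι] (s : Finset ι) (w a g : ι → ℝ) (j : ι) (O : ℝ) (hj : j ∈ s) :
    ∑ m ∈ s, Function.update w j O m * a m * g m = (∑ m ∈ s.erase j, w m * a m * g m) + O * a j * g j := by
  rw [← Finset.sum_erase_add s _ hj, Function.update_self]
  congr 1
  refine Finset.sum_congr rfl fun m hm => ?_
  rw [Function.update_of_ne (Finset.ne_of_mem_erase hm)]

/-- `∑ₛ (update w j O)ₘ·aₘ·gₘ = ∑ₛ wₘaₘgₘ` when `gⱼ = 0`. [folklore] -/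
theorem sum_update_of_zero {ι : Type*} [DecidableEq ι] (s : Finset ι) (w a g : ι → ℝ) (j : ι) (O : ℝ) (hj : j ∈ s) (hg : g j = 0) :
    ∑ m ∈ s, Function.update w j O m * a m * g m = ∑ m ∈ s, w m * a m * g m := by
  have e1 : ∑ m ∈ s, Function.update w j O m * a m * g m = ∑ m ∈ s, Function.update w j O m * (a m * g m) :=
    Finset.sum_congr rfl fun m _ => by ring
  have e2 : ∑ m ∈ s, w m * a m * g m = ∑ m ∈ s, w m * (a m * g m) := Finset.sum_congr rfl fun m _ => by ring
  rw [e1, e2, sum_update_mul s w _ j O hj, hg, mul_zero, mul_zero, add_zero]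


/-! ## 6. The first moment is negative at every lone-side critical point (any rates) -/

/-- **`S₁ < 0` ON THE LONE SIDE, FOR ANY RATES.**  If (E2) `∑βₘWₘ(T−tₘ)² = 0` holds with positive weights, `βₘ ≥ 0` for `m ≠ p`, `βⱼ > 0`,
the left letters at `tₘ ≤ tₚ` (`m ≠ p, j`) and `tₚ < T < tⱼ`, then `S₁ = ∑βₘWₘ(T−tₘ) < 0`.  Proof: `∑βₘWₘ(T−tₘ)·((T−tₘ) − (T−tₚ)) =
(E2) − (T−tₚ)S₁` has every term `≥ 0` (pivot term `0`, left terms `βW(T−tₘ)(tₚ−tₘ) ≥ 0`) and the lone term `βⱼWⱼ(T−tⱼ)(tₚ−tⱼ) > 0`.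
The pivot rate does not enter. [folklore] -/
theorem firstMoment_neg {ι : Type*} (s : Finset ι) (β t W : ι → ℝ) (T : ℝ) (p j : ι) (hj : j ∈ s)
    (hW : ∀ m ∈ s, 0 < W m) (hβ : ∀ m ∈ s, m ≠ p → 0 ≤ β m) (hβj : 0 < β j)
    (htp : ∀ m ∈ s, m ≠ p → m ≠ j → t m ≤ t p) (hpT : t p < T) (hTj : T < t j)
    (h2 : ∑ m ∈ s, β m * W m * (T - t m) ^ 2 = 0) :
    ∑ m ∈ s, β m * W m * (T - t m) < 0 := by
  have key : ∑ m ∈ s, β m * W m * (T - t m) * (t p - t m)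
      = (∑ m ∈ s, β m * W m * (T - t m) ^ 2) - (T - t p) * ∑ m ∈ s, β m * W m * (T - t m) := by
    rw [Finset.mul_sum, ← Finset.sum_sub_distrib]
    exact Finset.sum_congr rfl fun m _ => by ring
  have hpos : 0 < ∑ m ∈ s, β m * W m * (T - t m) * (t p - t m) := by
    refine Finset.sum_pos' ?_ ⟨j, hj, ?_⟩
    · intro m hm
      by_cases hmp : m = p
      · rw [hmp, sub_self, mul_zero]
      · by_cases hmj : m = j
        · rw [hmj]
          have h1 : β j * W j * (T - t j) < 0 := mul_neg_of_pos_of_neg (mul_pos hβj (hW j hj)) (by linarith)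
          exact (mul_pos_of_neg_of_neg h1 (by linarith)).le
        · have h0 := htp m hm hmp hmj
          exact mul_nonneg (mul_nonneg (mul_nonneg (hβ m hm hmp) (hW m hm).le) (by linarith)) (by linarith)
    · have h1 : β j * W j * (T - t j) < 0 := mul_neg_of_pos_of_neg (mul_pos hβj (hW j hj)) (by linarith)
      exact mul_pos_of_neg_of_neg h1 (by linarith)
  rw [key, h2, zero_sub] at hpos
  have hu : 0 < T - t p := by linarith
  by_contra hcon
  push Not at hcon
  have := mul_nonneg hu.le hcon
  linarith

end Summit.ValiantsHypothesis.ValiantsHypothesis.Theorems.LacunarySymmetroidMatrixDescartes.Pivot.CriticalWindows.Lone
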